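import Literature.AlgebraicGeometry.Frobenioids.MonoidFunctorsOnD
import Literature.AnabelianGeometry.EtaleTheta.TemperedFrobenioidHull
import Literature.AnabelianGeometry.EtaleTheta.FrdIVocabulary

/-!
# [EtTh] Definition 3.6 (iv): the functor `C^{bs-fld} → C` is faithful — proof

S. Mochizuki, *The étale theta function and its Frobenioid-theoretic manifestations*, Publ. RIMS **45**
(2009) [MochizukiEtTh2009], Definition 3.6 (iv), PDF p.78 (printed 304): "the data
`(D, Φ^{bs-fld}, F, F → (Φ^{bs-fld})^gp)` determines a model Frobenioid `C^{bs-fld}`, together with a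
natural **faithful** functor `C^{bs-fld} → C`".  The statement file `TemperedFrobenioidHull.lean`
(abc-iut-L2-t3) builds `hull : C.hullCategory ⥤ C.category` and records faithfulness as the named `Prop`
`HullFaithful`, noting that it "rests on the injectivity of `(Φ^{bs-fld})^gp → Φ^gp`, automatic for the
integral monoids of the text".  This proof-only companion (owner, gen 2) discharges it:

* `hullFaithful_of_isCancelMul` — `HullFaithful` holds as soon as the divisor monoids `Φ(A)` are
  cancellative (= integral): `hull` is the identity on `deg_Fr`, `Base`; on zero divisors it is the
  inclusion `Φ^{bs-fld}(A) ⊆ Φ(A)`; on unit components `(b, ξ) ↦ (b, ξ)` through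
  `(Φ^{bs-fld}(A))^gp → Φ(A)^gp`, injective for cancellative `Φ(A)` ([FrdI] §0; tree `gpMap_injective`);
* `hullFaithful` — unconditionally for the tree's [FrdI] vocabulary `treeMonoidVocab`: `Φ(A)` is
  perf-factorial (Def 3.6 (ii)), hence divisorial, hence integral.

HONEST FRAMING: refereed pre-IUT material; nothing here bears on [IUTchIII] Cor. 3.12.
-/

namespace Literature.AnabelianGeometry.EtaleTheta

open CategoryTheory Opposite Literature.AlgebraicGeometry.Frobenioids Function

universe u₀ v₀ u v w

namespace TemperedFrobenioid

variable {D₀ : Type u₀} [Category.{v₀} D₀] {V : FrdIMonoidStub.{w}}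
  {T : RealifiedDivisorMonoids (D₀ := D₀) V} {D : Type u} [Category.{v} D]
  {VD : FrdICatStub.{u, v, w} D} (C : TemperedFrobenioid T D VD)

/-- `Φ^{bs-fld}(A) ⊆ Φ(A)` is injective (a subtype inclusion). [cite: MochizukiEtTh2009, Def 3.6 p.78] -/
theorem bsFldInclM_injective (A : Dᵒᵖ) : Injective (C.bsFldInclM A) := by
  intro x y h
  have h' := congrArg Subtype.val h
  exact Subtype.ext h'

/-- A submonoid injecting into a cancellative monoid is cancellative: `Φ^{bs-fld}(A)` is cancellative when
`Φ(A)` is. [cite: MochizukiEtTh2009, Def 3.6 p.78] -/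
theorem isCancelMul_bsFld (A : Dᵒᵖ) (hΦ : IsCancelMul (C.Φ.carrier A)) :
    IsCancelMul (C.bsFldMonoid.obj A) := by
  haveI : IsCancelMul (C.divisorMonoid.obj A) := hΦ
  have hinj := C.bsFldInclM_injective A
  exact
    { mul_left_cancel := fun a b c h => by
        have h' : a * b = a * c := h
        have h2 := congrArg (C.bsFldInclM A) h'
        rw [map_mul, map_mul] at h2
        exact hinj (mul_left_cancel h2)
      mul_right_cancel := fun a b c h => by
        have h' : b * a = c * a := h
        have h2 := congrArg (C.bsFldInclM A) h'
        rw [map_mul, map_mul] at h2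
        exact hinj (mul_right_cancel h2) }

/-- `(Φ^{bs-fld}(A))^gp → Φ(A)^gp` is injective for cancellative `Φ(A)` ([FrdI] §0: groupification of an
injection of integral monoids). [cite: MochizukiEtTh2009, Def 3.6 p.78] -/
theorem bsFldInclGpM_injective (A : Dᵒᵖ) (hΦ : IsCancelMul (C.Φ.carrier A)) :
    Injective (C.bsFldInclGpM A) := by
  haveI : IsCancelMul (C.divisorMonoid.obj A) := hΦ
  haveI := C.isCancelMul_bsFld A hΦ
  exact Literature.AlgebraicGeometry.Frobenioids.gpMap_injective (C.bsFldInclM A) (C.bsFldInclM_injective A)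

/-- Components of the unit part of `hull`: `(b, ξ) ↦ (b, ξ ∈ Φ^gp)`. [cite: MochizukiEtTh2009, Def 3.6 p.78] -/
theorem coe_hullUnitM (A : Dᵒᵖ) (u : C.cnstFnBsFunctor.obj A) :
    (Subtype.val (C.hullUnitM A u) :
        (T.BΛ.obj (C.baseOp A) : Type w) × Algebra.GrothendieckGroup (C.Φ.carrier A)) =
      ((Subtype.val u).1, C.bsFldInclGpM A (Subtype.val u).2) := rfl

/-- The unit component of `hull`, `F^{bs}(A) → B(A)`, is injective for cancellative `Φ(A)`.
[cite: MochizukiEtTh2009, Def 3.6 p.78] -/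
theorem hullUnitM_injective (A : Dᵒᵖ) (hΦ : IsCancelMul (C.Φ.carrier A)) :
    Injective (C.hullUnitM A) := by
  intro u u' h
  have h' := congrArg Subtype.val h
  rw [coe_hullUnitM, coe_hullUnitM] at h'
  obtain ⟨h1, h2⟩ := Prod.mk.inj h'
  apply Subtype.ext
  exact Prod.ext h1 (C.bsFldInclGpM_injective A hΦ h2)

/-- **Definition 3.6 (iv), "a natural faithful functor `C^{bs-fld} → C`"** — `HullFaithful` holds whenever
the divisor monoids `Φ(A)` are cancellative (integral). [cite: MochizukiEtTh2009, Def 3.6 p.78] -/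
theorem hullFaithful_of_isCancelMul (hΦ : ∀ A : Dᵒᵖ, IsCancelMul (C.Φ.carrier A)) : C.HullFaithful := by
  refine ⟨fun {X Y} φ ψ h => ?_⟩
  have h1 := congrArg ModelFrobenioid.Hom.degFr h
  have h2 := congrArg ModelFrobenioid.Hom.base h
  have h3 := congrArg ModelFrobenioid.Hom.div h
  have h4 := congrArg ModelFrobenioid.Hom.unit h
  apply ModelFrobenioid.hom_ext
  · exact h1
  · exact h2
  · exact C.bsFldInclM_injective _ h3
  · exact C.hullUnitM_injective _ (hΦ _) h4

end TemperedFrobenioid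

/-- **Definition 3.6 (iv), faithfulness of `C^{bs-fld} → C`, DISCHARGED** for the tree's [FrdI] vocabulary:
the divisor monoid `Φ(A)` of a tempered Frobenioid is perf-factorial (Def 3.6 (ii)), hence divisorial,
hence integral = cancellative. [cite: MochizukiEtTh2009, Def 3.6 p.78] -/
theorem TemperedFrobenioid.hullFaithful {D₀ : Type u₀} [Category.{v₀} D₀]
    {T : RealifiedDivisorMonoids (D₀ := D₀) treeMonoidVocab.{w}} {D : Type u} [Category.{v} D]
    {VD : FrdICatStub.{u, v, w} D} (C : TemperedFrobenioid T D VD) : C.HullFaithful :=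
  C.hullFaithful_of_isCancelMul fun A =>
    isIntegral_iff_isCancelMul.mp (C.isPerfFactorial A).isDivisorial.isPreDivisorial.isIntegral

end Literature.AnabelianGeometry.EtaleTheta
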